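import Summits.BirchSwinnertonDyer.BirchSwinnertonDyer.Theorems.EdixhovenFibreFiveSevenTypeGOrdMemberManinUnitOfSL2NeronValuesBar
import Summits.BirchSwinnertonDyer.BirchSwinnertonDyer.Theorems.EdixhovenFibreFiveSevenRecTowerOrdinaryUnstarredAnyPrime
import Summits.BirchSwinnertonDyer.BirchSwinnertonDyer.Theorems.TeichmullerTwistDescentManinSideFiveSevenOfSL2NeronValuesBar
import Summits.BirchSwinnertonDyer.BirchSwinnertonDyer.Theorems.AdditiveKolyvaginRoadManinFrameResidueProperROfReciprocityLaw
import Summits.BirchSwinnertonDyer.BirchSwinnertonDyer.Theorems.ManinLocalTwoThreeManinPrimeToAdditiveFiveLeIsogenyMinimalDiscriminantRigidity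
import Summits.BirchSwinnertonDyer.Rank1Residual.Additive.GordIsogenyInvariance
import Summits.BirchSwinnertonDyer.Rank1Residual.Additive.GordKodairaType
import HarnessLib

/-!
# Manin's `p`-part at every lattice-optimal datum at an additive `p > 7` with a (G)-ordinary potentially good member, GRANTED ONLY {P1-bar, modularity};
# PSMU (22638), GE11 (23885), the TTD Manin side, AKR crux #7 `ManinFrameResidueProperR` (20709) BY NAME — [REC-tower] eliminated
# (route `EdixhovenFibreFiveSeven`, line `kato-lever`; seat `bsd-line-edix-p4` g31, width; joint with LEAD `bsd-line-edix-p1` g33)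

HONEST FRAMING. TOOL theorems only (no definition, no named fact, no instance, no `sorry`; file-local instance keys on `ℚ_v` byte-identical to the accepted
`…CellsOfRecTowerAtIntrinsicAlt` l.65–69); helper `--supports` PSMU stmt-BirchSwinnertonDyer-22638 (route TeichmullerTwistDescent, OPEN; same rung W-ALL/2.p>=5.r1).
PSMU / GE11 / AKR #7 stay OPEN — proved here CONDITIONALLY on P1-bar (`Kato2004.exists_member_sl2ZetaElement_neron_values_bar`, print XL, cite-only) and
modularity (`exists_isNewformOf`, cite-only; AKR #7 carries it inside its bundle binder). **BSD is not proved by any of this.**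

WHAT. The `p > 7` half of the Manin side. The LEAD's any-prime ordinary road (`…OrdinaryPotGoodModelsAnyPrime` p804419, `…LocalFormulaOrdinaryAnyPrime` p806318,
`…RecTowerOrdinaryUnstarredAnyPrime`: `recTowerOrdinaryUnstarred_of_typeGOrd` / `recTowerOrdinaryStarred_of_typeGOrd` — [REC-tower] PROVED at every cyclotomic tower for
every globally minimal (G)-ORDINARY curve with `ord_p Δ_min ∈ {2,3,4,8,9,10}` at ANY `p ≥ 5`, through this seat's `ordinaryCapstone_of_numerology` and generic turnkey)
plugs into this seat's class-membership socket `TypeGOrdMemberManinUnitOfSL2NeronValuesBar.not_dvd_optimal_c_of_typeGOrd_member_of_sl2NeronValuesBar_of_recAtMembers`: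

* `le_four_or_starred_of_forall_ne_Istar` — at an additive `p ≥ 5` with no `Iₙ*` fibre (`n ≥ 0`): `ord_p Δ_min ≤ 4 ∨ ord_p Δ_min ∈ {8, 9, 10}` (Tate's table).
* ★★ `recAtMembers_of_typeGOrd` — [REC-tower] at every cyclotomic tower for every globally minimal MEMBER of the class of a (G)-ordinary additive `W₁` with
  `ord_p Δ_min(W₁) ∈ {2,3,4,8,9,10}`, `p ≥ 5` (transport: `X2.addv_iff_of_isIsogenous`, `TypeGOrd.of_isIsogenous`,
  `padicValInt_minimalDiscriminantInt_eq_of_isIsogenous_of_typeGOrd`; then the LEAD's two cell theorems).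
* ★★★ `not_dvd_optimal_c_of_typeGOrd_member_of_sl2NeronValuesBar` — `W/ℚ` globally minimal, additive at `p > 7`, `E[p]` irreducible, SOME isogenous curve
  (G)-ordinary at `p`, SOME isogenous minimal curve without `Iₙ*` fibre at `p`, `D` lattice-optimal at any level ⇒ `p ∤ c(D)`, GRANTED ONLY P1-bar and modularity
  (= g19's `…_of_typeGOrd_member_of_expStarTower_…` WITHOUT hT₂; the extra «no `Iₙ*` member» binder excludes the `I₀*` row, where the CM-fibre method does not apply —
  every consumer below carries it).
* By name, GRANTED ONLY {modularity, P1-bar}: ★★★ `principalSeriesOptimalManinUnit_of_sl2NeronValuesBar` (PSMU 22638: `p ∈ {5,7}` by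
  `not_dvd_optimal_c_potGood_of_sl2NeronValuesBar`, `p > 7` by the above), ★★★ `ordinaryLowValuationOptimalManinUnitGeEleven_of_sl2NeronValuesBar` (GE11 23885),
  ★★ `maninSide_of_sl2NeronValuesBar` (all SEVEN TTD Manin decls from {P1-bar, `PublishedInputsAdditiveKoly`}), ★★★ `maninFrameResidueProperR_of_sl2NeronValuesBar :
  P1-bar → ManinFrameResidueProperR` (AKR crux #7, 20709; modularity and Hoffstein–Luo from its bundle binder).

NET: with `…PotGoodManinUnitOfSL2NeronValuesBar` (p805274) the WHOLE Manin side of W-ALL/2.p>=5.r1 in the three routes (EF57, TTD, AKR #7) rests on {P1-bar, modularity};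
Kato 1993 II Thm. 1.4.1 (4) is no longer an input anywhere on it except through the item TDS11 (22228; LEAD g33's `…TwistDegreeStepOrdinaryOfSL2NeronValuesBar`).
CONDITIONAL; every item stays OPEN; BSD is not proved.

References: [Kato2004Asterisque] Thm. 6.6 (1), (8.1.3), Thm. 9.7; [Kato1993LNM1553] Ch. II Prop. 1.2.3, Thm. 1.4.1 (3)–(4); [DokchitserDokchitser2015LocalInvariants] Thm. 3.2,
Thm. 5.1 (1); [KrausOesterle1992] Prop. 1; [Stevens1989] Thm. (5.1), Lemma (5.2); [EdixhovenManin1991] Thm. 3; [HoffsteinLuo1997] Theorem; [SilvermanATAEC1994] IV Table 4.1.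
-/

set_option autoImplicit false
-- the Theorems namespace of a single-conjunct summit repeats the summit name by design (D-0017)
set_option linter.dupNamespace false

noncomputable section

open scoped Classical MatrixGroups NumberField NNReal

open WeierstrassCurve NumberField IsDedekindDomain Field ValuativeRel
  Literature.NumberTheory.EllipticCurves Literature.NumberTheory.EllipticCurves.ModularForms
  Literature.NumberTheory.EllipticCurves.Rank1Residual Literature.NumberTheory.EllipticCurves.Kato2004
  Literature.NumberTheory.DiophantineGeometry Rat.HeightOneSpectrum
  Literature.NumberTheory.PAdicHodge Literature.NumberTheory.GaloisRepresentations
  Literature.NumberTheory.GaloisRepresentations.IsNonarchimedeanLocalField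
  Literature.NumberTheory.GaloisRepresentations.PeriodRingData
  Summit.BirchSwinnertonDyer.Rank1Residual Summit.BirchSwinnertonDyer.Rank1Residual.Additive
  Summit.BirchSwinnertonDyer.Rank1Residual.GaloisImage
  Summit.BirchSwinnertonDyer.BirchSwinnertonDyer.Theorems
  Summit.BirchSwinnertonDyer.BirchSwinnertonDyer.Theorems.KimAtThreeDeepLowerExpStarOmega
  Summit.BirchSwinnertonDyer.BirchSwinnertonDyer.Theorems.KimAtThreeDeepLowerExpStarOmegaPlace
  Summit.BirchSwinnertonDyer.BirchSwinnertonDyer.Theorems.TypeGOrdMemberManinUnitOfSL2NeronValuesBar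
  Summit.BirchSwinnertonDyer.BirchSwinnertonDyer.Theorems.PotGoodManinUnitOfSL2NeronValuesBar
  Summit.BirchSwinnertonDyer.BirchSwinnertonDyer.Theorems.UnstarredOrdinaryManinUnitOfSL2NeronValuesBar
  Summit.BirchSwinnertonDyer.BirchSwinnertonDyer.Theorems.TeichmullerTwistDescentManinSideFiveSevenOfSL2NeronValuesBar
  Summit.BirchSwinnertonDyer.BirchSwinnertonDyer.Theses.TeichmullerTwistDescent
  CongruenceSubgroup Complex
open Summit.BirchSwinnertonDyer.BirchSwinnertonDyer.Theorems.KimAtThreeDeepUpperTowerLattice (fact_natCast_mem_primesEquiv_symm)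
open Literature.NumberTheory.EllipticCurves.FormalGroupChart (padicLogPointFiniteExt)

namespace Summit.BirchSwinnertonDyer.BirchSwinnertonDyer.Theorems.TypeGOrdManinUnitOfSL2NeronValuesBar

-- FILE-LOCAL instance keys, byte-identical to the accepted `…CellsOfRecTowerAtIntrinsicAlt.lean` l.65–69 (no library instance is
-- overridden outside this file): the `Fact (p ∈ v_p)` key and the local-field structures on `ℚ_v = Place.Completion (inr v)`, under
-- which the [REC-tower] body at `ℚ_v ⊆ ℚ(ζ_m)_w` is stated.
attribute [local instance] fact_natCast_mem_primesEquiv_symm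
attribute [local instance 100000] NumberField.Place.instAlgebraCompletion
attribute [local instance] valuativeRelPlace topologicalSpacePlace
attribute [local instance] isNonarchimedeanLocalField_place charZero_place
attribute [local instance] padicAlgebraPlace fact_not_isUnit_place isAdicComplete_place

variable {p : ℕ} [hp : Fact p.Prime]

/-! ### §1 Members of a (G)-ordinary potentially good class: cell data and [REC-tower] -/

/-- **Tate's table at an additive `p ≥ 5` without `Iₙ*` fibre (`n ≥ 0`)**: `ord_p Δ_min ≤ 4` (II, III, IV) or `ord_p Δ_min ∈ {8, 9, 10}` (IV*, III*, II*)
(`kodairaSymbolAt_placeOf_cases_of_addv`). [cite: SilvermanATAEC1994, IV Table 4.1] -/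
theorem le_four_or_starred_of_forall_ne_Istar (W : WeierstrassCurve ℚ) [W.IsElliptic] [W.IsGloballyMinimal] (hp5 : 5 ≤ p) (hadd : Addv W p)
    (hK : ∀ n : ℕ, W.kodairaSymbolAt (placeOf p) ≠ .Istar n) :
    padicValInt p W.minimalDiscriminantInt ≤ 4 ∨ (padicValInt p W.minimalDiscriminantInt = 8 ∨ padicValInt p W.minimalDiscriminantInt = 9 ∨
      padicValInt p W.minimalDiscriminantInt = 10) := by
  rcases kodairaSymbolAt_placeOf_cases_of_addv W p hp5 hadd with
    ⟨-, h⟩ | ⟨-, h⟩ | ⟨-, h⟩ | ⟨m, h, -⟩ | ⟨-, h⟩ | ⟨-, h⟩ | ⟨-, h⟩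
  · exact Or.inl (by omega)
  · exact Or.inl (by omega)
  · exact Or.inl (by omega)
  · exact absurd h (hK m)
  · exact Or.inr (Or.inl h)
  · exact Or.inr (Or.inr (Or.inl h))
  · exact Or.inr (Or.inr (Or.inr h))

/-- ★★ **[REC-tower] at every cyclotomic tower `ℚ_v ⊆ ℚ(ζ_m)_w` (`p ∤ m`) for every globally minimal MEMBER of the class of a (G)-ordinary additive curve `W₁` with
`ord_p Δ_min(W₁) ∈ {2,3,4,8,9,10}`, at any `p ≥ 5`.** Transport to the member `W′ ∼ W₁`: `Addv` (`X2.addv_iff_of_isIsogenous`), `TypeGOrd` (`TypeGOrd.of_isIsogenous`),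
`ord_p Δ_min` (`padicValInt_minimalDiscriminantInt_eq_of_isIsogenous_of_typeGOrd`, Dokchitser–Dokchitser potentially-ordinary clause as a theorem); then the LEAD's
`recTowerOrdinaryUnstarred_of_typeGOrd` (`ord_p Δ_min ≤ 4`) / `recTowerOrdinaryStarred_of_typeGOrd` (`∈ {8,9,10}`). UNCONDITIONAL.
[cite: Kato1993LNM1553, Ch. II §1.2.4, Prop. 1.2.3 and Thm. 1.4.1 (3)–(4)] [cite: DokchitserDokchitser2015LocalInvariants, Thm. 3.2 and Thm. 5.1 (1)] -/
theorem recAtMembers_of_typeGOrd (hp5 : 5 ≤ p) (W₁ : WeierstrassCurve ℚ) [W₁.IsElliptic] [W₁.IsGloballyMinimal] (hadd₁ : Addv W₁ p)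
    (hG₁ : TypeGOrd W₁ p)
    (hv₁ : padicValInt p W₁.minimalDiscriminantInt ≤ 4 ∨ (padicValInt p W₁.minimalDiscriminantInt = 8 ∨ padicValInt p W₁.minimalDiscriminantInt = 9 ∨
      padicValInt p W₁.minimalDiscriminantInt = 10)) :
    ∀ (W' : WeierstrassCurve ℚ) [W'.IsElliptic] [W'.IsGloballyMinimal], IsIsogenous W₁ W' →
      ∀ (m : ℕ) [NeZero m], ¬ p ∣ m →
      ∀ (w : ((primesEquiv (R := 𝓞 ℚ)).symm ⟨p, hp.out⟩).Extension (𝓞 (CyclotomicField m ℚ))) (hw : ((p : ℕ) : 𝓞 (CyclotomicField m ℚ)) ∈ w.1.asIdeal)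
      [CharZero (w.1.adicCompletion (CyclotomicField m ℚ))] [Fact (¬ IsUnit ((p : ℕ) : integerC (w.1.adicCompletion (CyclotomicField m ℚ))))]
      [IsAdicComplete (Ideal.span {((p : ℕ) : integerC (w.1.adicCompletion (CyclotomicField m ℚ)))}) (integerC (w.1.adicCompletion (CyclotomicField m ℚ)))]
      (hL : valuation (w.1.adicCompletion (CyclotomicField m ℚ)) ((p : ℕ) : (w.1.adicCompletion (CyclotomicField m ℚ))) < 1), letI := LocalField.adicCompletionPadicAlgebra w.1 p hw
      letI : Algebra (Place.Completion (K := ℚ) (Sum.inr ((primesEquiv (R := 𝓞 ℚ)).symm ⟨p, hp.out⟩))) (w.1.adicCompletion (CyclotomicField m ℚ)) :=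
      inferInstanceAs (Algebra (((primesEquiv (R := 𝓞 ℚ)).symm ⟨p, hp.out⟩).adicCompletion ℚ) (w.1.adicCompletion (CyclotomicField m ℚ)))
      ∀ (wv : Valuation (Place.Completion (Sum.inr ((primesEquiv (R := 𝓞 ℚ)).symm ⟨p, hp.out⟩) : Place ℚ)) ℝ≥0) [wv.Compatible]
      [(W'.baseChange (Place.Completion (Sum.inr ((primesEquiv (R := 𝓞 ℚ)).symm ⟨p, hp.out⟩) : Place ℚ))).IsIntegral wv.integer]
      (ν : Valuation (w.1.adicCompletion (CyclotomicField m ℚ)) ℝ≥0) [ν.Compatible] [(W'.baseChange (w.1.adicCompletion (CyclotomicField m ℚ))).IsIntegral ν.integer]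
      (e : (k : ℕ) → geomTorsion W' ((p ^ k : ℕ) : ℤ) → geomTorsion W' ((p ^ k : ℕ) : ℤ) → AlgebraicClosure ℚ) (hμ : ∀ k S T, e k S T ^ (p ^ k) = 1)
      (hadd₁ : ∀ k S₁ S₂ T, e k (S₁ + S₂) T = e k S₁ T * e k S₂ T) (hadd₂ : ∀ k S T₁ T₂, e k S (T₁ + T₂) = e k S T₁ * e k S T₂)
      (hgal : ∀ k (σ : absoluteGaloisGroup ℚ) (S T : geomTorsion W' ((p ^ k : ℕ) : ℤ)), σ • e k S T = e k (σ • S) (σ • T))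
      (_hnondeg : ∀ k (T : geomTorsion W' ((p ^ k : ℕ) : ℤ)), (∀ S, e k S T = 1) → T = 0) (_halt : ∀ k (S : geomTorsion W' ((p ^ k : ℕ) : ℤ)), e k S S = 1)
      (hcompat : ∀ k (S T : geomTorsion W' ((p ^ (k + 1) : ℕ) : ℤ)),
      e k (torsionMulHom W' (p ^ (k + 1)) (p ^ k) p (pow_succ p k).symm S) (torsionMulHom W' (p ^ (k + 1)) (p ^ k) p (pow_succ p k).symm T) = e (k + 1) S T ^ p)
      (d₀ : LocalNeronLineAt W' p ((primesEquiv (R := 𝓞 ℚ)).symm ⟨p, hp.out⟩)) (d : LocalNeronLine W' hL ((galRestrictPlace ((primesEquiv (R := 𝓞 ℚ)).symm ⟨p, hp.out⟩)).comp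
      (absGaloisRestrict (Place.Completion (Sum.inr ((primesEquiv (R := 𝓞 ℚ)).symm ⟨p, hp.out⟩) : Place ℚ)) (w.1.adicCompletion (CyclotomicField m ℚ))))),
      (bdRPeriodRingData (valuation_place_lt_one p ((primesEquiv (R := 𝓞 ℚ)).symm ⟨p, hp.out⟩))).CupLogInjective (logCyclotomic p)
      (localRationalTateRep W' p (galRestrictPlace ((primesEquiv (R := 𝓞 ℚ)).symm ⟨p, hp.out⟩))) →
      (∀ z : contOneCocycles (localRationalTateRep W' p (galRestrictPlace ((primesEquiv (R := 𝓞 ℚ)).symm ⟨p, hp.out⟩))).toTopRep,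
      (bdRPeriodRingData (valuation_place_lt_one p ((primesEquiv (R := 𝓞 ℚ)).symm ⟨p, hp.out⟩))).HasDualExp (logCyclotomic p)
      (localRationalTateRep W' p (galRestrictPlace ((primesEquiv (R := 𝓞 ℚ)).symm ⟨p, hp.out⟩))) fun σ => z.1 σ) →
      (bdRPeriodRingData (F := (w.1.adicCompletion (CyclotomicField m ℚ))) (p := p) hL).CupLogInjective (logCyclotomic p) (localRationalTateRep W' p
      ((galRestrictPlace ((primesEquiv (R := 𝓞 ℚ)).symm ⟨p, hp.out⟩)).comp (absGaloisRestrict (Place.Completion (Sum.inr ((primesEquiv (R := 𝓞 ℚ)).symm ⟨p, hp.out⟩) : Place ℚ)) (w.1.adicCompletion (CyclotomicField m ℚ))))) →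
      (∀ z : contOneCocycles (localRationalTateRep W' p
      ((galRestrictPlace ((primesEquiv (R := 𝓞 ℚ)).symm ⟨p, hp.out⟩)).comp (absGaloisRestrict (Place.Completion (Sum.inr ((primesEquiv (R := 𝓞 ℚ)).symm ⟨p, hp.out⟩) : Place ℚ)) (w.1.adicCompletion (CyclotomicField m ℚ))))).toTopRep,
      (bdRPeriodRingData (F := (w.1.adicCompletion (CyclotomicField m ℚ))) (p := p) hL).HasDualExp (logCyclotomic p) (localRationalTateRep W' p
      ((galRestrictPlace ((primesEquiv (R := 𝓞 ℚ)).symm ⟨p, hp.out⟩)).comp (absGaloisRestrict (Place.Completion (Sum.inr ((primesEquiv (R := 𝓞 ℚ)).symm ⟨p, hp.out⟩) : Place ℚ)) (w.1.adicCompletion (CyclotomicField m ℚ)))))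
      fun σ => z.1 σ) → (∀ (η₀ : contOneCocycles (restrictedTateRep W' (Place.Completion (Sum.inr ((primesEquiv (R := 𝓞 ℚ)).symm ⟨p, hp.out⟩) : Place ℚ)) p).toTopRep)
      (ηT : contOneCocycles ((restrictedTateRep W' (Place.Completion (Sum.inr ((primesEquiv (R := 𝓞 ℚ)).symm ⟨p, hp.out⟩) : Place ℚ)) p).restrict
      (absGaloisRestrict (Place.Completion (Sum.inr ((primesEquiv (R := 𝓞 ℚ)).symm ⟨p, hp.out⟩) : Place ℚ)) (w.1.adicCompletion (CyclotomicField m ℚ)))).toTopRep),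
      (∀ σ, ηT.1 σ = η₀.1 (absGaloisRestrict (Place.Completion (Sum.inr ((primesEquiv (R := 𝓞 ℚ)).symm ⟨p, hp.out⟩) : Place ℚ)) (w.1.adicCompletion (CyclotomicField m ℚ)) σ)) →
      expStarCoordTower W' (F₀ := (Place.Completion (Sum.inr ((primesEquiv (R := 𝓞 ℚ)).symm ⟨p, hp.out⟩) : Place ℚ))) hL d ηT =
      algebraMap (Place.Completion (Sum.inr ((primesEquiv (R := 𝓞 ℚ)).symm ⟨p, hp.out⟩) : Place ℚ)) (w.1.adicCompletion (CyclotomicField m ℚ))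
      (expStarCoord W' (valuation_place_lt_one p ((primesEquiv (R := 𝓞 ℚ)).symm ⟨p, hp.out⟩)) d₀ η₀)) →
      ∃ c : (Place.Completion (Sum.inr ((primesEquiv (R := 𝓞 ℚ)).symm ⟨p, hp.out⟩) : Place ℚ)), c ≠ 0 ∧
      (∀ (η₀ : contOneCocycles (restrictedTateRep W' (Place.Completion (Sum.inr ((primesEquiv (R := 𝓞 ℚ)).symm ⟨p, hp.out⟩) : Place ℚ)) p).toTopRep)
      (P : (W'.baseChange (Place.Completion (Sum.inr ((primesEquiv (R := 𝓞 ℚ)).symm ⟨p, hp.out⟩) : Place ℚ))).toAffine.Point),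
      ((tatePairingPoint W' (Place.Completion (Sum.inr ((primesEquiv (R := 𝓞 ℚ)).symm ⟨p, hp.out⟩) : Place ℚ)) p e hμ hadd₁ hadd₂ hgal hcompat (oneCocycleClass _ η₀) P : ℤ_[p]) : ℚ_[p]) =
      Algebra.trace ℚ_[p] (Place.Completion (Sum.inr ((primesEquiv (R := 𝓞 ℚ)).symm ⟨p, hp.out⟩) : Place ℚ))
      (c * expStarCoord W' (valuation_place_lt_one p ((primesEquiv (R := 𝓞 ℚ)).symm ⟨p, hp.out⟩)) d₀ η₀ *
      padicLogPointFiniteExt wv (W'.baseChange (Place.Completion (Sum.inr ((primesEquiv (R := 𝓞 ℚ)).symm ⟨p, hp.out⟩) : Place ℚ))) p P)) ∧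
      (∀ (ηT : contOneCocycles ((restrictedTateRep W' (Place.Completion (Sum.inr ((primesEquiv (R := 𝓞 ℚ)).symm ⟨p, hp.out⟩) : Place ℚ)) p).restrict
      (absGaloisRestrict (Place.Completion (Sum.inr ((primesEquiv (R := 𝓞 ℚ)).symm ⟨p, hp.out⟩) : Place ℚ)) (w.1.adicCompletion (CyclotomicField m ℚ)))).toTopRep)
      (P : (W'.baseChange (w.1.adicCompletion (CyclotomicField m ℚ))).toAffine.Point),
      ((tatePairingPointTower W' (Place.Completion (Sum.inr ((primesEquiv (R := 𝓞 ℚ)).symm ⟨p, hp.out⟩) : Place ℚ)) e hμ hadd₁ hadd₂ hgal hcompat (oneCocycleClass _ ηT) P : ℤ_[p]) : ℚ_[p]) =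
      Algebra.trace ℚ_[p] (w.1.adicCompletion (CyclotomicField m ℚ))
      (algebraMap (Place.Completion (Sum.inr ((primesEquiv (R := 𝓞 ℚ)).symm ⟨p, hp.out⟩) : Place ℚ)) (w.1.adicCompletion (CyclotomicField m ℚ)) c * expStarCoordTower W' (F₀ := (Place.Completion (Sum.inr ((primesEquiv (R := 𝓞 ℚ)).symm ⟨p, hp.out⟩) : Place ℚ))) hL d ηT *
      padicLogPointFiniteExt ν (W'.baseChange (w.1.adicCompletion (CyclotomicField m ℚ))) p P)) := by
  intro W' _ _ hiso'
  have hp2 : p ≠ 2 := by omega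
  have hadd' : Addv W' p := (X2.addv_iff_of_isIsogenous (p := p) hiso').mp hadd₁
  have hG' : TypeGOrd W' p := TypeGOrd.of_isIsogenous hp2 hadd₁ hG₁ hiso'
  have hΔ : padicValInt p W₁.minimalDiscriminantInt = padicValInt p W'.minimalDiscriminantInt :=
    padicValInt_minimalDiscriminantInt_eq_of_isIsogenous_of_typeGOrd hp5 hiso' hadd₁ hG₁
  rw [hΔ] at hv₁
  rcases hv₁ with h4 | hst
  · exact RecTowerOrdinaryUnstarredAnyPrime.recTowerOrdinaryUnstarred_of_typeGOrd W' p hp5 hadd' h4 hG'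
  · exact RecTowerOrdinaryUnstarredAnyPrime.recTowerOrdinaryStarred_of_typeGOrd W' p hp5 hadd' hst hG'

/-! ### §2 The optimal Manin unit at `p > 7`, [REC-tower] eliminated -/

/-- ★★★ **Manin's `p`-part at every lattice-optimal datum of every `W/ℚ` additive at `p > 7` with `E[p]` irreducible, SOME isogenous curve (G)-ordinary at `p`
and SOME isogenous minimal curve without `Iₙ*` fibre at `p` (`n ≥ 0`), GRANTED ONLY P1-bar and modularity**: `D` lattice-optimal at any level ⇒ `p ∤ c(D)`.
The class-membership socket `not_dvd_optimal_c_of_typeGOrd_member_of_sl2NeronValuesBar_of_recAtMembers` DISCHARGED by `recAtMembers_of_typeGOrd` at the (G)-ordinary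
member `W₁` (its `ord_p Δ_min ∈ {2,3,4,8,9,10}` from the no-`Iₙ*` member moved along the class, `IstarIsogenyInvariance`, and Tate's table). CONDITIONAL on the
cite-only P1-bar / modularity; nothing is closed. [cite: Kato2004Asterisque, Thm. 6.6 (1) (p. 163), (8.1.3) (p. 180), Thm. 9.7 (p. 189)]
[cite: Kato1993LNM1553, Ch. II Prop. 1.2.3 and Thm. 1.4.1 (3)–(4)] [cite: DokchitserDokchitser2015LocalInvariants, Thm. 3.2] [cite: KrausOesterle1992, Prop. 1] -/
theorem not_dvd_optimal_c_of_typeGOrd_member_of_sl2NeronValuesBar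
    (hP1 : exists_member_sl2ZetaElement_neron_values_bar) (hnf : exists_isNewformOf)
    (W : WeierstrassCurve ℚ) [W.IsElliptic] [W.IsGloballyMinimal] {N : ℕ} [NeZero N]
    (D : ModularParametrizationData W N) (hp7 : 7 < p) (hadd : Addv W p) (hirr : Irr W p)
    (hG : ∃ (W' : WeierstrassCurve ℚ) (_ : W'.IsElliptic) (_ : W'.IsGloballyMinimal), IsIsogenous W W' ∧ TypeGOrd W' p)
    (hI : ∃ (W' : WeierstrassCurve ℚ) (_ : W'.IsElliptic) (_ : W'.IsGloballyMinimal),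
      IsIsogenous W W' ∧ ∀ (v : HeightOneSpectrum ℤ) (n : ℕ), natGenerator v = p → W'.kodairaSymbolAt v ≠ KodairaSymbol.Istar n)
    (hopt : ∀ z ∈ D.L.lattice, ∃ w ∈ periodLattice D.f, z = D.c * w) :
    ¬ (p : ℤ) ∣ D.c := by
  have hp5 : 5 ≤ p := by omega
  have hp2 : p ≠ 2 := by omega
  obtain ⟨W₁, hE₁, hM₁, hiso₁, hG₁⟩ := hG
  haveI := hE₁
  haveI := hM₁
  have hadd₁ : Addv W₁ p := (X2.addv_iff_of_isIsogenous (p := p) hiso₁).mp hadd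
  -- no `Iₙ*` at the (G)-ordinary member (moved along the class), hence its `ord_p Δ_min ∈ {2,3,4,8,9,10}`
  obtain ⟨W₂, hE₂, hM₂, hiso₂, hK₂⟩ := hI
  haveI := hE₂
  have hK₁ : ∀ n : ℕ, W₁.kodairaSymbolAt (placeOf p) ≠ .Istar n :=
    TeichmullerTwistDescent.forall_ne_Istar_of_member W₁ p hp2 ⟨W₂, hE₂, hM₂, (hiso₁.symm_of_charZero).trans' hiso₂, hK₂⟩
  have hv₁ := le_four_or_starred_of_forall_ne_Istar W₁ hp5 hadd₁ hK₁
  refine not_dvd_optimal_c_of_typeGOrd_member_of_sl2NeronValuesBar_of_recAtMembers hP1 hnf W D hp7 hadd hirr ⟨W₁, hE₁, hM₁, hiso₁, hG₁⟩ ?_ hopt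
  intro W' _ _ hiso'
  exact recAtMembers_of_typeGOrd hp5 W₁ hadd₁ hG₁ hv₁ W' ((hiso₁.symm_of_charZero).trans' hiso')

/-! ### §3 The items by name, GRANTED ONLY {modularity, P1-bar} -/

/-- ★★★ **PSMU `PrincipalSeriesOptimalManinUnit` (stmt-BirchSwinnertonDyer-22638) GRANTED ONLY modularity and P1-bar**: at `p ∈ {5, 7}` by
`not_dvd_optimal_c_potGood_of_sl2NeronValuesBar` (no `Iₙ*` at `W` read off the potentially good member), at `p > 7` by `not_dvd_optimal_c_of_typeGOrd_member_of_sl2NeronValuesBar`.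
[REC-tower] is NO LONGER an input. CONDITIONAL; the item stays OPEN; BSD is not proved by this. [cite: Kato2004Asterisque, (8.1.3) (p. 180), Thm. 9.7 (p. 189)]
[cite: Stevens1989, Thm. (5.1)] [cite: Kato1993LNM1553, Ch. II Thm. 1.4.1 (3)–(4)] -/
theorem principalSeriesOptimalManinUnit_of_sl2NeronValuesBar (hnf : exists_isNewformOf)
    (hP1 : exists_member_sl2ZetaElement_neron_values_bar) :
    PrincipalSeriesOptimalManinUnit := by
  intro W _ _ p _ N _ D hp5 hadd hirr hG hI hopt
  by_cases hp7 : 7 < p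
  · exact not_dvd_optimal_c_of_typeGOrd_member_of_sl2NeronValuesBar hP1 hnf W D hp7 hadd hirr hG hI hopt
  · have hp57 : p = 5 ∨ p = 7 := by
      have hpr : p.Prime := Fact.out
      interval_cases p
      · exact Or.inl rfl
      · exact absurd hpr (by norm_num)
      · exact Or.inr rfl
    have hK := (TeichmullerTwistDescent.forall_ne_Istar_iff_placeOf W p).2
      (TeichmullerTwistDescent.forall_ne_Istar_of_member W p (by omega) hI)
    exact not_dvd_optimal_c_potGood_of_sl2NeronValuesBar hP1 hnf W D hp57 hadd hirr hK hopt

/-- ★★★ **GE11 `OrdinaryLowValuationOptimalManinUnitGeEleven` (stmt-BirchSwinnertonDyer-23885) GRANTED ONLY modularity and P1-bar** — the curve itself is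
(G)-ordinary with `ord_p Δ_min ≤ 4` (so no `Iₙ*`: `forall_ne_Istar_of_padicValInt_le_four`). [REC-tower] is NO LONGER an input (the LEAD's
`recTowerOrdinaryUnstarred_of_typeGOrd`). CONDITIONAL; the item stays OPEN. [cite: Kato2004Asterisque, (8.1.3) (p. 180), Thm. 9.7 (p. 189)] [cite: EdixhovenManin1991, Thm. 3] -/
theorem ordinaryLowValuationOptimalManinUnitGeEleven_of_sl2NeronValuesBar (hnf : exists_isNewformOf)
    (hP1 : exists_member_sl2ZetaElement_neron_values_bar) :
    OrdinaryLowValuationOptimalManinUnitGeEleven := by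
  intro W _ _ p _ _ D hp11 hadd hirr hG h4 hopt
  exact not_dvd_optimal_c_of_typeGOrd_member_of_sl2NeronValuesBar hP1 hnf W D (by omega) hadd hirr
    ⟨W, ‹_›, ‹_›, isIsogenous_self W, hG⟩
    ⟨W, ‹_›, ‹_›, isIsogenous_self W, OptimalManinUnitFiveSevenOfReciprocityLaw.forall_ne_Istar_of_padicValInt_le_four W (by omega) hadd h4⟩ hopt

/-- ★★ **All SEVEN Manin-side decls of route TeichmullerTwistDescent — PSMU, SCMU57, CORNER, LOW, WILD, TAME, GE11 — GRANTED ONLY P1-bar and the published-input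
bundle `PublishedInputsAdditiveKoly` (for modularity).** = g19's `maninSide_of_reciprocityLaw_of_sl2NeronValuesBar` WITHOUT `hrec`. CONDITIONAL; nothing closed; BSD is
not proved by this. [cite: Kato2004Asterisque, Thm. 6.6 (1) (p. 163), (8.1.3) (p. 180), Thm. 9.7 (p. 189)] -/
theorem maninSide_of_sl2NeronValuesBar (hP1 : exists_member_sl2ZetaElement_neron_values_bar) (hP : PublishedInputsAdditiveKoly) :
    PrincipalSeriesOptimalManinUnit ∧ SupercuspidalOptimalManinUnitFiveSeven ∧
      KummerCornerTorsionOptimalManinUnit ∧ SupersingularTorsionOptimalManinUnitFive ∧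
      KummerCornerWildManinUnit ∧ KummerCornerTameManinUnit ∧ OrdinaryLowValuationOptimalManinUnitGeEleven := by
  have hnf : exists_isNewformOf := hP.2.2.2.2.2.1
  exact ⟨principalSeriesOptimalManinUnit_of_sl2NeronValuesBar hnf hP1,
    supercuspidalOptimalManinUnitFiveSeven_of_sl2NeronValuesBar hnf hP1,
    -- CORNER / LOW: the sibling route's closers serve verbatim (the two routes' copies of the decls have identical bodies)
    UnstarredOrdinaryManinUnitOfSL2NeronValuesBar.kummerCornerTorsionOptimalManinUnit_of_sl2NeronValuesBar hnf hP1,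
    PotGoodManinUnitOfSL2NeronValuesBar.supersingularTorsionOptimalManinUnitFive_of_sl2NeronValuesBar hnf hP1,
    kummerCornerWildManinUnit_of_sl2NeronValuesBar hnf hP1,
    kummerCornerTameManinUnit_of_sl2NeronValuesBar hnf hP1,
    ordinaryLowValuationOptimalManinUnitGeEleven_of_sl2NeronValuesBar hnf hP1⟩

/-- ★★★ **AKR crux #7 `ManinFrameResidueProperR` (stmt-BirchSwinnertonDyer-20709; route AdditiveKolyvaginRoad) GRANTED ONLY P1-bar** (modularity and Hoffstein–Luo come
from the item's own bundle binder `PublishedInputsAdditiveKoly`). Manin's `p`-part at the lattice-optimal datum of the optimal member: `p ∈ {5, 7}` by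
`not_dvd_optimal_c_potGood_of_sl2NeronValuesBar`, `p ≥ 11` by `not_dvd_optimal_c_of_typeGOrd_member_of_sl2NeronValuesBar` (the (G)-ordinary member and the no-`Iₙ*`
member of the residue clause); transport and frame as in g19's `maninFrameResidueProperR_of_expStarTower_of_sl2NeronValuesBar`. [REC-tower] is NO LONGER an input.
CONDITIONAL; the item stays OPEN; BSD is not proved by this. [cite: Kato2004Asterisque, Thm. 6.6 (1) (p. 163), (8.1.3) (p. 180), Thm. 9.7 (p. 189)]
[cite: KostersPannekoek2017, Thm. 1 and Cor. 2] [cite: HoffsteinLuo1997, Theorem (p. 1)] -/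
theorem maninFrameResidueProperR_of_sl2NeronValuesBar (hP1 : exists_member_sl2ZetaElement_neron_values_bar) :
    Summit.BirchSwinnertonDyer.BirchSwinnertonDyer.Theses.AdditiveKolyvaginRoad.ManinFrameResidueProperR := by
  intro _e1 _e2 _dd hPub W _ _ p hp _ hp5 hadd hirr hres _hall hr
  have hnf : exists_isNewformOf := hPub.2.2.2.2.2.1
  have hpr : p.Prime := hp.out
  have hp2 : p ≠ 2 := by omega
  -- the optimal member of the class of `W`, with its lattice-optimal datum at level `N(W)`
  obtain ⟨W₀, hE₀, hM₀, hNe₀, D₀'', hiso, hN, hopt''⟩ := X12.exists_isIsogenous_optimal hnf W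
  haveI := hE₀
  haveI := hM₀
  haveI := hNe₀
  obtain ⟨D₀, hopt₀⟩ := X12.exists_optimalDatum_of_level_eq hN D₀'' hopt''
  have hadd₀ : Addv W₀ p := (X2.addv_iff_of_isIsogenous (p := p) hiso).mp hadd
  have hirr₀ : Irr W₀ p := (X12.irr_iff_of_isIsogenous hiso p).mp hirr
  -- Manin's `p`-part at `D₀`
  have hc₀ : ¬ (p : ℤ) ∣ D₀.c := by
    obtain ⟨hord, W', hE', hM', hiso', hK'⟩ := hres
    haveI := hE'
    haveI := hM'
    by_cases hp7 : 7 < p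
    · rcases hord with h11 | ⟨W'', hE'', hM'', hiso'', hG'', -⟩
      · exfalso
        interval_cases p <;> exact absurd hpr (by norm_num)
      · haveI := hE''
        haveI := hM''
        exact not_dvd_optimal_c_of_typeGOrd_member_of_sl2NeronValuesBar hP1 hnf W₀ D₀ hp7 hadd₀ hirr₀
          ⟨W'', hE'', hM'', (hiso.symm_of_charZero).trans' hiso'', hG''⟩
          ⟨W', hE', hM', (hiso.symm_of_charZero).trans' hiso', hK'⟩ hopt₀
    · have hp57 : p = 5 ∨ p = 7 := by
        interval_cases p
        · exact Or.inl rfl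
        · exact absurd hpr (by norm_num)
        · exact Or.inr rfl
      have hK₀ := (TeichmullerTwistDescent.forall_ne_Istar_iff_placeOf W₀ p).2
        (TeichmullerTwistDescent.forall_ne_Istar_of_member W₀ p hp2 ⟨W', hE', hM', (hiso.symm_of_charZero).trans' hiso', hK'⟩)
      exact not_dvd_optimal_c_potGood_of_sl2NeronValuesBar hP1 hnf W₀ D₀ hp57 hadd₀ hirr₀ hK₀ hopt₀
  -- transport to a datum of `W` with `p ∤ c`, then the Hoffstein–Luo odd Heegner frame
  obtain ⟨Dt, hc⟩ := ManinFrameTransport.exists_modularParametrizationData_not_dvd_of_partner W hp.out hirr hiso D₀ hc₀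
  exact ManinFrameFromDatum.exists_oddHeegnerFrame_of_exists_not_dvd hnf hPub.2.2.2.2.2.2.1 W p hr hp2 ⟨Dt, hc⟩

end Summit.BirchSwinnertonDyer.BirchSwinnertonDyer.Theorems.TypeGOrdManinUnitOfSL2NeronValuesBar

end
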